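import Literature.NumberTheory.LFunctions.LFDSingleKernel
import Mathlib.Analysis.SpecificLimits.Basic
import HarnessLib

/-!
# Log-free zero density for one character, VI: the averaged zero detector, finite form

Topic `Literature/NumberTheory/LFunctions`, sub-namespace `LFDSingle`. Everything here is PROVED.
With the scale-averaged weights of part IV,

  `w̃_n = J⁻² Σ_{j,j'<J} (e^{-n/X_{jj'}} − e^{-n/Y_{jj'}})`, `X_{jj'} = X R^{-(j+j')/J}`, `Y_{jj'} = Y R^{-(j+j')/J}`,

the zero detector of a zero `ρ` of `L(s, χ)` (`3/4 ≤ β ≤ 1`) is the FINITE sum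
`D(ρ) = Σ_{n ≤ N₁} c(n) χ(n) n^{-ρ} w̃_n` (`c = (ψ∗1)(θ∗1)`, the Graham weights of part I). We
prove `|D(ρ) + 1| ≤ E` (`norm_detector_add_one_le`) with

  `E = 512 K₁(X/R²) + (R²/Y + ⌊V⌋⌊W⌋ (1 + Y) e^{-U/Y}) + 2 ⌊V⌋⌊W⌋ (1 + X) e^{-N₁/X}`:

the `X`-parts are small by the contour shift of part I (`norm_tsum_bcoef_exp_le`, at the scale
`X_{jj'} ≥ X/R²`), the `Y`-parts are `e^{-1/Y_{jj'}} +` (terms `n > U`, since `c(n) = 0` for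
`1 < n ≤ U`), and the tails `n > N₁` are geometrically small. We also record `0 ≤ w̃_n ≤ e^{-n/X}`.

## References
* D. R. Heath-Brown, PLMS 64 (1992), §11 (11.8)–(11.9). [cite: HeathBrown1992PLMS, §11]
-/

noncomputable section

open Finset Real Complex
open Literature.NumberTheory.Sieve Literature.NumberTheory.Sieve.GrahamWeights

namespace Literature.NumberTheory.LFunctions.LFDSingle

/-! ### Geometric tails -/

/-- `Σ_{n ≥ 0} e^{-(n + M + 1)/Z} ≤ (1 + Z) e^{-M/Z}` (`Z > 0`). [folklore] -/
theorem tsum_exp_tail_le {Z : ℝ} (hZ : 0 < Z) (M : ℕ) :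
    ∑' n : ℕ, Real.exp (-(((n + (M + 1) : ℕ) : ℝ)) / Z) ≤ (1 + Z) * Real.exp (-(M : ℝ) / Z) := by
  set r : ℝ := Real.exp (-(1 / Z)) with hr
  have hr0 : 0 ≤ r := Real.exp_nonneg _
  have hr1 : r < 1 := Real.exp_lt_one_iff.2 (by rw [neg_lt_zero]; positivity)
  have hterm : ∀ n : ℕ, Real.exp (-(((n + (M + 1) : ℕ) : ℝ)) / Z) = Real.exp (-((M + 1 : ℕ) : ℝ) / Z) * r ^ n := by
    intro n
    rw [hr, ← Real.exp_nat_mul, ← Real.exp_add]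
    congr 1
    push_cast
    field_simp
    ring
  simp_rw [hterm]
  rw [tsum_mul_left, tsum_geometric_of_lt_one hr0 hr1]
  -- `(1 - r)⁻¹ ≤ 1 + Z` and `e^{-(M+1)/Z} ≤ e^{-M/Z}`
  have h1r : (1 - r)⁻¹ ≤ 1 + Z := by
    have ht : 1 / Z ≤ Real.exp (1 / Z) - 1 := by have := Real.add_one_le_exp (1 / Z); linarith
    have hexp : r = (Real.exp (1 / Z))⁻¹ := by rw [hr, Real.exp_neg]
    have hE : 1 < Real.exp (1 / Z) := Real.one_lt_exp_iff.2 (by positivity)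
    rw [hexp]
    have hE0 : 0 < Real.exp (1 / Z) := Real.exp_pos _
    rw [show (1 - (Real.exp (1 / Z))⁻¹) = (Real.exp (1 / Z) - 1) / Real.exp (1 / Z) by field_simp,
      inv_div, div_le_iff₀ (by linarith)]
    -- `E ≤ (1 + Z)(E - 1)` since `Z (E - 1) ≥ 1`
    have hZE : 1 ≤ Z * (Real.exp (1 / Z) - 1) := by
      have h1 := mul_le_mul_of_nonneg_left ht hZ.le
      have h2 : Z * (1 / Z) = 1 := by field_simp
      linarith
    have key : (1 + Z) * (Real.exp (1 / Z) - 1) = (Real.exp (1 / Z) - 1) + Z * (Real.exp (1 / Z) - 1) := by ring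
    rw [key]; linarith
  have hM : Real.exp (-((M + 1 : ℕ) : ℝ) / Z) ≤ Real.exp (-(M : ℝ) / Z) := by
    refine Real.exp_le_exp.2 ?_
    rw [div_le_div_iff_of_pos_right hZ]; push_cast; linarith
  calc Real.exp (-((M + 1 : ℕ) : ℝ) / Z) * (1 - r)⁻¹ ≤ Real.exp (-(M : ℝ) / Z) * (1 + Z) :=
        mul_le_mul hM h1r (by have := inv_nonneg.2 (by linarith : (0:ℝ) ≤ 1 - r); exact this) (Real.exp_nonneg _)
    _ = (1 + Z) * Real.exp (-(M : ℝ) / Z) := mul_comm _ _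

/-- A sequence dominated by `B e^{-n/Z}` from `M + 1` on has a summable tail with
`‖Σ_{n > M} f n‖ ≤ B (1 + Z) e^{-M/Z}`. [folklore] -/
theorem norm_tsum_tail_le {f : ℕ → ℂ} {B Z : ℝ} (hB : 0 ≤ B) (hZ : 0 < Z)
    (hf : ∀ n : ℕ, 1 ≤ n → ‖f n‖ ≤ B * Real.exp (-(n : ℝ) / Z)) (M : ℕ) :
    Summable (fun n => f (n + (M + 1))) ∧
      ‖∑' n : ℕ, f (n + (M + 1))‖ ≤ B * ((1 + Z) * Real.exp (-(M : ℝ) / Z)) := by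
  have hg : Summable fun n : ℕ => B * Real.exp (-(((n + (M + 1) : ℕ) : ℝ)) / Z) := by
    set r : ℝ := Real.exp (-(1 / Z)) with hr
    have hr0 : 0 ≤ r := Real.exp_nonneg _
    have hr1 : r < 1 := Real.exp_lt_one_iff.2 (by rw [neg_lt_zero]; positivity)
    have hterm : ∀ n : ℕ, B * Real.exp (-(((n + (M + 1) : ℕ) : ℝ)) / Z) =
        (B * Real.exp (-((M + 1 : ℕ) : ℝ) / Z)) * r ^ n := by
      intro n
      rw [hr, ← Real.exp_nat_mul, mul_assoc, ← Real.exp_add]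
      congr 2
      push_cast; field_simp; ring
    simp_rw [hterm]
    exact (summable_geometric_of_lt_one hr0 hr1).mul_left _
  have hbound : ∀ n : ℕ, ‖f (n + (M + 1))‖ ≤ B * Real.exp (-(((n + (M + 1) : ℕ) : ℝ)) / Z) := by
    intro n
    have := hf (n + (M + 1)) (by omega)
    exact_mod_cast this
  have hs : Summable fun n => f (n + (M + 1)) := Summable.of_norm_bounded hg hbound
  refine ⟨hs, ?_⟩
  calc ‖∑' n : ℕ, f (n + (M + 1))‖ ≤ ∑' n : ℕ, ‖f (n + (M + 1))‖ := norm_tsum_le_tsum_norm hs.norm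
    _ ≤ ∑' n : ℕ, B * Real.exp (-(((n + (M + 1) : ℕ) : ℝ)) / Z) :=
        Summable.tsum_le_tsum hbound hs.norm hg
    _ = B * ∑' n : ℕ, Real.exp (-(((n + (M + 1) : ℕ) : ℝ)) / Z) := tsum_mul_left
    _ ≤ B * ((1 + Z) * Real.exp (-(M : ℝ) / Z)) := mul_le_mul_of_nonneg_left (tsum_exp_tail_le hZ M) hB

/-! ### The averaged weights -/

/-- `w̃_n = J⁻² Σ_{j,j'<J} (e^{-n/X_{jj'}} − e^{-n/Y_{jj'}})`. [cite: HeathBrown1992PLMS, §11 (11.11)] -/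
def wAvg (X Y R : ℝ) (J : ℕ) (n : ℕ) : ℝ :=
  ((J : ℝ) ^ 2)⁻¹ * ∑ j ∈ range J, ∑ j' ∈ range J,
    (Real.exp (-(n / (X * R ^ (-scaleExp j j' J)))) - Real.exp (-(n / (Y * R ^ (-scaleExp j j' J)))))

/-- Each summand is in `[0, e^{-n/X}]` when `0 < Y ≤ X`, `R ≥ 1`. [folklore] -/
theorem weight_term_mem {X Y R : ℝ} (hY : 0 < Y) (hYX : Y ≤ X) (hR : 1 ≤ R) (j j' J : ℕ) (n : ℕ) :
    0 ≤ Real.exp (-(n / (X * R ^ (-scaleExp j j' J)))) - Real.exp (-(n / (Y * R ^ (-scaleExp j j' J)))) ∧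
    Real.exp (-(n / (X * R ^ (-scaleExp j j' J)))) - Real.exp (-(n / (Y * R ^ (-scaleExp j j' J)))) ≤
      Real.exp (-(n / X)) := by
  have hR0 : 0 < R := by linarith
  have hpow : 0 < R ^ (-scaleExp j j' J) := Real.rpow_pos_of_pos hR0 _
  have hpow1 : R ^ (-scaleExp j j' J) ≤ 1 :=
    Real.rpow_le_one_of_one_le_of_nonpos hR (by linarith [scaleExp_nonneg j j' J])
  have hX : 0 < X := by linarith
  have hn : (0 : ℝ) ≤ n := Nat.cast_nonneg n
  constructor
  · rw [sub_nonneg, Real.exp_le_exp, neg_le_neg_iff]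
    exact div_le_div_of_nonneg_left hn (mul_pos hY hpow) (mul_le_mul_of_nonneg_right hYX hpow.le)
  · have h1 : Real.exp (-(n / (X * R ^ (-scaleExp j j' J)))) ≤ Real.exp (-(n / X)) := by
      rw [Real.exp_le_exp, neg_le_neg_iff]
      refine div_le_div_of_nonneg_left hn (mul_pos hX hpow) ?_
      calc X * R ^ (-scaleExp j j' J) ≤ X * 1 := mul_le_mul_of_nonneg_left hpow1 hX.le
        _ = X := mul_one X
    have h2 : 0 ≤ Real.exp (-(n / (Y * R ^ (-scaleExp j j' J)))) := Real.exp_nonneg _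
    linarith

/-- `0 ≤ w̃_n ≤ e^{-n/X}`. [folklore] -/
theorem wAvg_mem {X Y R : ℝ} (hY : 0 < Y) (hYX : Y ≤ X) (hR : 1 ≤ R) {J : ℕ} (hJ : 0 < J) (n : ℕ) :
    0 ≤ wAvg X Y R J n ∧ wAvg X Y R J n ≤ Real.exp (-(n / X)) := by
  have hJ' : (0 : ℝ) < (J : ℝ) ^ 2 := by positivity
  unfold wAvg
  constructor
  · refine mul_nonneg (by positivity) (sum_nonneg fun j _ => sum_nonneg fun j' _ => ?_)
    exact (weight_term_mem hY hYX hR j j' J n).1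
  · calc ((J : ℝ) ^ 2)⁻¹ * ∑ j ∈ range J, ∑ j' ∈ range J,
          (Real.exp (-(n / (X * R ^ (-scaleExp j j' J)))) - Real.exp (-(n / (Y * R ^ (-scaleExp j j' J)))))
        ≤ ((J : ℝ) ^ 2)⁻¹ * ∑ j ∈ range J, ∑ j' ∈ range J, Real.exp (-(n / X)) := by
          refine mul_le_mul_of_nonneg_left (sum_le_sum fun j _ => sum_le_sum fun j' _ => ?_) (by positivity)
          exact (weight_term_mem hY hYX hR j j' J n).2
      _ = Real.exp (-(n / X)) := by
          rw [sum_const, sum_const, card_range, nsmul_eq_mul, nsmul_eq_mul]; field_simp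


/-! ### Truncation of the exponentially weighted detector sums -/

variable {q : ℕ} (χ : DirichletCharacter ℂ q)
variable {U V W : ℝ}

/-- `‖b(n)‖ ≤ ⌊V⌋⌊W⌋` for `n ≥ 1`, `re ρ ≥ 0`. [folklore] -/
theorem norm_bcoef_le (hU : 1 ≤ U) (hUV : U < V) (hW : 1 < W) {ρ : ℂ} (hρ : 0 ≤ ρ.re) {n : ℕ}
    (hn : 1 ≤ n) : ‖bcoef χ U V W ρ n‖ ≤ (⌊V⌋₊ : ℝ) * ⌊W⌋₊ := by
  have hn0 : 0 < n := hn
  rw [bcoef, norm_mul, norm_mul, Complex.norm_real, Real.norm_eq_abs,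
    Complex.norm_natCast_cpow_of_pos hn0, Complex.neg_re]
  have h1 : (n : ℝ) ^ (-ρ.re) ≤ 1 :=
    Real.rpow_le_one_of_one_le_of_nonpos (by exact_mod_cast hn) (by linarith)
  calc |coef U V W n| * ‖χ n‖ * (n : ℝ) ^ (-ρ.re) ≤ (⌊V⌋₊ : ℝ) * ⌊W⌋₊ * 1 * 1 :=
        mul_le_mul (mul_le_mul (abs_coef_le hU hUV hW n) (DirichletCharacter.norm_le_one χ _)
          (norm_nonneg _) (by positivity)) h1 (by positivity) (by positivity)
    _ = _ := by ring

/-- The summands `f_Z(n) = b(n) e^{-n/Z}` (`f_Z(0) = 0`). [folklore] -/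
def detTerm (U V W : ℝ) (ρ : ℂ) (Z : ℝ) (n : ℕ) : ℂ :=
  if n = 0 then 0 else bcoef χ U V W ρ n * (Real.exp (-(n * Z⁻¹)) : ℂ)

/-- `‖f_Z(n)‖ ≤ ⌊V⌋⌊W⌋ e^{-n/Z}` (`n ≥ 1`). [folklore] -/
theorem norm_detTerm_le (hU : 1 ≤ U) (hUV : U < V) (hW : 1 < W) {ρ : ℂ} (hρ : 0 ≤ ρ.re) (Z : ℝ)
    (n : ℕ) (hn : 1 ≤ n) :
    ‖detTerm χ U V W ρ Z n‖ ≤ (⌊V⌋₊ : ℝ) * ⌊W⌋₊ * Real.exp (-(n : ℝ) / Z) := by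
  rw [detTerm, if_neg (by omega), norm_mul, Complex.norm_real, Real.norm_of_nonneg (Real.exp_nonneg _),
    show (-(n * Z⁻¹ : ℝ)) = -(n : ℝ) / Z by ring]
  exact mul_le_mul_of_nonneg_right (norm_bcoef_le χ hU hUV hW hρ hn) (Real.exp_nonneg _)

/-- Summability of `f_Z` (`Z > 0`). [folklore] -/
theorem summable_detTerm (hU : 1 ≤ U) (hUV : U < V) (hW : 1 < W) {ρ : ℂ} (hρ : 0 ≤ ρ.re) {Z : ℝ}
    (hZ : 0 < Z) : Summable (detTerm χ U V W ρ Z) := by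
  have h := (norm_tsum_tail_le (f := detTerm χ U V W ρ Z) (by positivity) hZ
    (fun n hn => norm_detTerm_le χ hU hUV hW hρ Z n hn) 0).1
  exact (summable_nat_add_iff 1).1 h

/-- **Truncation**: `Σ' f_Z = Σ_{1 ≤ n ≤ N₁} b(n) e^{-n/Z} + T` with `‖T‖ ≤ ⌊V⌋⌊W⌋(1 + Z) e^{-N₁/Z}`.
[folklore] -/
theorem tsum_detTerm_eq_sum_add (hU : 1 ≤ U) (hUV : U < V) (hW : 1 < W) {ρ : ℂ} (hρ : 0 ≤ ρ.re)
    {Z : ℝ} (hZ : 0 < Z) (N₁ : ℕ) :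
    ∃ T : ℂ, ‖T‖ ≤ (⌊V⌋₊ : ℝ) * ⌊W⌋₊ * ((1 + Z) * Real.exp (-(N₁ : ℝ) / Z)) ∧
      ∑' n : ℕ, detTerm χ U V W ρ Z n =
        ∑ n ∈ Icc 1 N₁, bcoef χ U V W ρ n * (Real.exp (-(n * Z⁻¹)) : ℂ) + T := by
  obtain ⟨hs, hT⟩ := norm_tsum_tail_le (f := detTerm χ U V W ρ Z) (by positivity) hZ
    (fun n hn => norm_detTerm_le χ hU hUV hW hρ Z n hn) N₁
  refine ⟨∑' n : ℕ, detTerm χ U V W ρ Z (n + (N₁ + 1)), hT, ?_⟩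
  rw [← (summable_detTerm χ hU hUV hW hρ hZ).sum_add_tsum_nat_add (N₁ + 1)]
  congr 1
  rw [Finset.range_eq_Ico, Finset.sum_eq_sum_Ico_succ_bot (by omega), detTerm, if_pos rfl, zero_add]
  have : Finset.Ico 1 (N₁ + 1) = Finset.Icc 1 N₁ := rfl
  rw [this]
  refine sum_congr rfl fun n hn => ?_
  rw [detTerm, if_neg (by have := (mem_Icc.1 hn).1; omega)]

/-- **The lower cutoff**: `Σ' f_Y = e^{-1/Y} + T_U` with `‖T_U‖ ≤ ⌊V⌋⌊W⌋(1 + Y) e^{-⌊U⌋/Y}`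
(`c(n) = 0` for `1 < n ≤ U`). [cite: HeathBrown1992PLMS, §11 (11.9)] -/
theorem tsum_detTerm_eq_exp_add (hU : 1 ≤ U) (hUV : U < V) (hW : 1 < W) {ρ : ℂ} (hρ : 0 ≤ ρ.re)
    {Y : ℝ} (hY : 0 < Y) :
    ∃ T : ℂ, ‖T‖ ≤ (⌊V⌋₊ : ℝ) * ⌊W⌋₊ * ((1 + Y) * Real.exp (-(⌊U⌋₊ : ℝ) / Y)) ∧
      ∑' n : ℕ, detTerm χ U V W ρ Y n = (Real.exp (-(Y⁻¹)) : ℂ) + T := by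
  obtain ⟨T, hT, heq⟩ := tsum_detTerm_eq_sum_add χ hU hUV hW hρ hY ⌊U⌋₊
  refine ⟨T, hT, ?_⟩
  rw [heq]
  congr 1
  have hU1 : 1 ≤ ⌊U⌋₊ := Nat.le_floor (by exact_mod_cast hU)
  rw [Finset.sum_eq_single_of_mem 1 (mem_Icc.2 ⟨le_rfl, hU1⟩)]
  · rw [bcoef, coef_one hU hUV hW]
    simp
  · intro n hn hn1
    have hn2 : 1 < n := by have := (mem_Icc.1 hn).1; omega
    have hnU : (n : ℝ) ≤ U := by
      have := (mem_Icc.1 hn).2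
      exact le_trans (by exact_mod_cast this) (Nat.floor_le (by linarith))
    rw [bcoef, coef_eq_zero hU hUV hn2 hnU]
    simp


/-! ### The averaged detector -/

/-- `D(ρ) = Σ_{1 ≤ n ≤ N₁} b(n) w̃_n`. [cite: HeathBrown1992PLMS, §11 (11.9)] -/
def detector (U V W X Y R : ℝ) (J N₁ : ℕ) (ρ : ℂ) : ℂ :=
  ∑ n ∈ Icc 1 N₁, bcoef χ U V W ρ n * (wAvg X Y R J n : ℂ)

/-- Monotonicity of the tail majorant `(1 + Z) e^{-M/Z}` in `Z`. [folklore] -/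
theorem tail_mono {Z₁ Z₂ M : ℝ} (hZ₁ : 0 < Z₁) (h : Z₁ ≤ Z₂) (hM : 0 ≤ M) :
    (1 + Z₁) * Real.exp (-M / Z₁) ≤ (1 + Z₂) * Real.exp (-M / Z₂) := by
  have hZ₂ : 0 < Z₂ := by linarith
  refine mul_le_mul (by linarith) (Real.exp_le_exp.2 ?_) (Real.exp_nonneg _) (by linarith)
  rw [neg_div, neg_div, neg_le_neg_iff]
  exact div_le_div_of_nonneg_left hM hZ₁ h

/-- The detection constant `K₁(X') = (256π²e/3) q^{5/4−β} (log q + 1)(2 + |γ|) ⌊V⌋⌊W⌋ X'^{-1/4}`.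
[cite: HeathBrown1992PLMS, §11 (11.9)] -/
def detConst (q : ℕ) (V W X' : ℝ) (ρ : ℂ) : ℝ :=
  256 * π ^ 2 * Real.exp 1 / 3 * (q : ℝ) ^ (5 / 4 - ρ.re) * (Real.log q + 1) *
    (2 + |ρ.im|) * ((⌊V⌋₊ : ℝ) * ⌊W⌋₊) * X' ^ (-(1 / 4 : ℝ))

/-- `K₁` is antitone in `X'`. [folklore] -/
theorem detConst_mono (q : ℕ) (V W : ℝ) (ρ : ℂ) {X₁ X₂ : ℝ} (hX₁ : 0 < X₁) (h : X₁ ≤ X₂) :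
    detConst q V W X₂ ρ ≤ detConst q V W X₁ ρ := by
  unfold detConst
  have hq : (0 : ℝ) ≤ Real.log q + 1 := by
    have : 0 ≤ Real.log q := Real.log_natCast_nonneg q
    linarith
  refine mul_le_mul_of_nonneg_left (Real.rpow_le_rpow_of_nonpos hX₁ h (by norm_num)) (by positivity)

set_option maxHeartbeats 1600000 in
/-- **The averaged zero detector is close to `−1`.** For `χ ≠ χ₀` mod `q ≥ 8`, Graham weights with
`1 ≤ U < V`, `W > 1`, scales `R ≥ 1`, `R² ≤ Y ≤ X`, `J ≥ 1`, any `N₁`, and a zero `ρ = β + iγ` of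
`L(s, χ)` with `3/4 ≤ β ≤ 1`:
`‖D(ρ) + 1‖ ≤ 512 K₁(X/R²) + R²/Y + ⌊V⌋⌊W⌋(1 + Y)e^{-⌊U⌋/Y} + 2⌊V⌋⌊W⌋(1 + X)e^{-N₁/X}`.
[cite: HeathBrown1992PLMS, §11 (11.8)–(11.9)] -/
theorem norm_detector_add_one_le [NeZero q] (hχ : χ ≠ 1) (hq : 8 ≤ q) (hU : 1 ≤ U) (hUV : U < V)
    (hW : 1 < W) {X Y R : ℝ} {J : ℕ} (hR : 1 ≤ R) (hY : R ^ 2 ≤ Y) (hYX : Y ≤ X) (hJ : 0 < J)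
    (N₁ : ℕ) {ρ : ℂ} (hρ0 : χ.LFunction ρ = 0) (hρ : 3 / 4 ≤ ρ.re) (hρ1 : ρ.re ≤ 1) :
    ‖detector χ U V W X Y R J N₁ ρ + 1‖ ≤
      512 * detConst q V W (X / R ^ 2) ρ + R ^ 2 / Y +
        (⌊V⌋₊ : ℝ) * ⌊W⌋₊ * ((1 + Y) * Real.exp (-(⌊U⌋₊ : ℝ) / Y)) +
        2 * ((⌊V⌋₊ : ℝ) * ⌊W⌋₊ * ((1 + X) * Real.exp (-(N₁ : ℝ) / X))) := by
  have hR0 : 0 < R := by linarith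
  have hR2 : 1 ≤ R ^ 2 := one_le_pow₀ hR
  have hY1 : 1 ≤ Y := hR2.trans hY
  have hY0 : 0 < Y := by linarith
  have hX0 : 0 < X := by linarith
  have hρre0 : 0 ≤ ρ.re := by linarith
  have hJ' : (J : ℂ) ≠ 0 := by exact_mod_cast hJ.ne'
  have hJ2 : (0 : ℝ) < (J : ℝ) ^ 2 := by positivity
  have hVW : 0 ≤ (⌊V⌋₊ : ℝ) * ⌊W⌋₊ := by positivity
  -- the scales
  set t : ℕ → ℕ → ℝ := fun j j' => scaleExp j j' J with ht
  have hscale : ∀ j ∈ range J, ∀ j' ∈ range J,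
      X / R ^ 2 ≤ X * R ^ (-t j j') ∧ X * R ^ (-t j j') ≤ X ∧
      1 ≤ Y * R ^ (-t j j') ∧ Y * R ^ (-t j j') ≤ Y ∧ Y * R ^ (-t j j') ≤ X * R ^ (-t j j') := by
    intro j hj j' hj'
    have ht0 := scaleExp_nonneg j j' J
    have ht2 := scaleExp_le_two (mem_range.1 hj) (mem_range.1 hj')
    have hpos : 0 < R ^ (-t j j') := Real.rpow_pos_of_pos hR0 _
    have hlo : R ^ (-(2 : ℝ)) ≤ R ^ (-t j j') := Real.rpow_le_rpow_of_exponent_le hR (by simp only [ht]; linarith)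
    have hhi : R ^ (-t j j') ≤ 1 := Real.rpow_le_one_of_one_le_of_nonpos hR (by simp only [ht]; linarith)
    have hR2' : R ^ (-(2 : ℝ)) = (R ^ 2)⁻¹ := by
      rw [Real.rpow_neg hR0.le, show (2 : ℝ) = ((2 : ℕ) : ℝ) by norm_num, Real.rpow_natCast]
    refine ⟨?_, ?_, ?_, ?_, mul_le_mul_of_nonneg_right hYX hpos.le⟩
    · rw [div_eq_mul_inv, ← hR2']; exact mul_le_mul_of_nonneg_left hlo hX0.le
    · calc X * R ^ (-t j j') ≤ X * 1 := mul_le_mul_of_nonneg_left hhi hX0.le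
        _ = X := mul_one X
    · calc (1 : ℝ) = R ^ 2 * (R ^ 2)⁻¹ := by field_simp
        _ ≤ Y * R ^ (-t j j') := by rw [← hR2']; exact mul_le_mul hY hlo (by positivity) hY0.le
    · calc Y * R ^ (-t j j') ≤ Y * 1 := mul_le_mul_of_nonneg_left hhi hY0.le
        _ = Y := mul_one Y
  -- the per-scale bound
  set E : ℝ := 512 * detConst q V W (X / R ^ 2) ρ + R ^ 2 / Y +
    (⌊V⌋₊ : ℝ) * ⌊W⌋₊ * ((1 + Y) * Real.exp (-(⌊U⌋₊ : ℝ) / Y)) +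
    2 * ((⌊V⌋₊ : ℝ) * ⌊W⌋₊ * ((1 + X) * Real.exp (-(N₁ : ℝ) / X))) with hE
  have hper : ∀ j ∈ range J, ∀ j' ∈ range J,
      ‖(∑ n ∈ Icc 1 N₁, bcoef χ U V W ρ n *
          ((Real.exp (-(n / (X * R ^ (-t j j')))) - Real.exp (-(n / (Y * R ^ (-t j j')))) : ℝ) : ℂ)) + 1‖ ≤ E := by
    intro j hj j' hj'
    obtain ⟨hXlo, hXhi, hY1', hYhi, hYX'⟩ := hscale j hj j' hj'
    set X' := X * R ^ (-t j j') with hX'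
    set Y' := Y * R ^ (-t j j') with hY'
    have hX'1 : 1 ≤ X' := hY1'.trans hYX'
    have hX'0 : 0 < X' := by linarith
    have hY'0 : 0 < Y' := by linarith
    -- split the finite sum into the two exponential sums
    have hsplit : ∑ n ∈ Icc 1 N₁, bcoef χ U V W ρ n *
        ((Real.exp (-(n / X')) - Real.exp (-(n / Y')) : ℝ) : ℂ) =
        ∑ n ∈ Icc 1 N₁, bcoef χ U V W ρ n * (Real.exp (-(n * X'⁻¹)) : ℂ) -
          ∑ n ∈ Icc 1 N₁, bcoef χ U V W ρ n * (Real.exp (-(n * Y'⁻¹)) : ℂ) := by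
      rw [← sum_sub_distrib]
      refine sum_congr rfl fun n _ => ?_
      rw [show (n / X' : ℝ) = n * X'⁻¹ by ring, show (n / Y' : ℝ) = n * Y'⁻¹ by ring]
      push_cast; ring
    obtain ⟨T₁, hT₁, h1⟩ := tsum_detTerm_eq_sum_add χ hU hUV hW hρre0 hX'0 N₁
    obtain ⟨T₂, hT₂, h2⟩ := tsum_detTerm_eq_sum_add χ hU hUV hW hρre0 hY'0 N₁
    obtain ⟨T₃, hT₃, h3⟩ := tsum_detTerm_eq_exp_add χ hU hUV hW hρre0 hY'0
    have hSX : ‖∑' n : ℕ, detTerm χ U V W ρ X' n‖ ≤ 512 * detConst q V W X' ρ :=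
      norm_tsum_bcoef_exp_le χ hχ hq hU hUV hW hX'1 hρ0 hρ hρ1
    -- the identity `A - B + 1 = S_X' - T₁ - (e^{-1/Y'} + T₃ - T₂) + 1`
    have hA : ∑ n ∈ Icc 1 N₁, bcoef χ U V W ρ n * (Real.exp (-(n * X'⁻¹)) : ℂ) =
        ∑' n : ℕ, detTerm χ U V W ρ X' n - T₁ := by rw [h1]; ring
    have hB : ∑ n ∈ Icc 1 N₁, bcoef χ U V W ρ n * (Real.exp (-(n * Y'⁻¹)) : ℂ) =
        (Real.exp (-(Y'⁻¹)) : ℂ) + T₃ - T₂ := by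
      have := h2; rw [h3] at this; linear_combination (-1 : ℂ) * this
    rw [hsplit, hA, hB]
    have hexp1 : ‖(1 : ℂ) - (Real.exp (-(Y'⁻¹)) : ℂ)‖ ≤ R ^ 2 / Y := by
      rw [show (1 : ℂ) - (Real.exp (-(Y'⁻¹)) : ℂ) = ((1 - Real.exp (-(Y'⁻¹)) : ℝ) : ℂ) by push_cast; ring,
        Complex.norm_real, Real.norm_of_nonneg (by
          have : Real.exp (-(Y'⁻¹)) ≤ 1 := Real.exp_le_one_iff.2 (by rw [neg_nonpos]; positivity)
          linarith)]
      have h1 : 1 - Real.exp (-(Y'⁻¹)) ≤ Y'⁻¹ := by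
        have := Real.add_one_le_exp (-(Y'⁻¹)); linarith
      have h2 : Y'⁻¹ ≤ R ^ 2 / Y := by
        rw [inv_le_comm₀ hY'0 (by positivity), inv_div]
        calc Y / R ^ 2 = Y * (R ^ 2)⁻¹ := div_eq_mul_inv _ _
          _ ≤ Y * R ^ (-t j j') := by
              have hlo : R ^ (-(2 : ℝ)) ≤ R ^ (-t j j') :=
                Real.rpow_le_rpow_of_exponent_le hR (by
                  have := scaleExp_le_two (mem_range.1 hj) (mem_range.1 hj'); simp only [ht]; linarith)
              have hR2' : R ^ (-(2 : ℝ)) = (R ^ 2)⁻¹ := by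
                rw [Real.rpow_neg hR0.le, show (2 : ℝ) = ((2 : ℕ) : ℝ) by norm_num, Real.rpow_natCast]
              rw [← hR2']; exact mul_le_mul_of_nonneg_left hlo hY0.le
          _ = Y' := rfl
      linarith
    have hK : 512 * detConst q V W X' ρ ≤ 512 * detConst q V W (X / R ^ 2) ρ :=
      mul_le_mul_of_nonneg_left (detConst_mono q V W ρ (by positivity) hXlo) (by norm_num)
    have hT₁' : ‖T₁‖ ≤ (⌊V⌋₊ : ℝ) * ⌊W⌋₊ * ((1 + X) * Real.exp (-(N₁ : ℝ) / X)) :=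
      hT₁.trans (mul_le_mul_of_nonneg_left (tail_mono hX'0 hXhi (Nat.cast_nonneg _)) hVW)
    have hT₂' : ‖T₂‖ ≤ (⌊V⌋₊ : ℝ) * ⌊W⌋₊ * ((1 + X) * Real.exp (-(N₁ : ℝ) / X)) :=
      hT₂.trans (mul_le_mul_of_nonneg_left (tail_mono hY'0 (hYX'.trans hXhi) (Nat.cast_nonneg _)) hVW)
    have hT₃' : ‖T₃‖ ≤ (⌊V⌋₊ : ℝ) * ⌊W⌋₊ * ((1 + Y) * Real.exp (-(⌊U⌋₊ : ℝ) / Y)) :=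
      hT₃.trans (mul_le_mul_of_nonneg_left (tail_mono hY'0 hYhi (Nat.cast_nonneg _)) hVW)
    calc ‖∑' n : ℕ, detTerm χ U V W ρ X' n - T₁ - ((Real.exp (-(Y'⁻¹)) : ℂ) + T₃ - T₂) + 1‖
        = ‖∑' n : ℕ, detTerm χ U V W ρ X' n + ((1 : ℂ) - (Real.exp (-(Y'⁻¹)) : ℂ)) + (-T₃) + (-T₁) + T₂‖ := by
          ring_nf
      _ ≤ ‖∑' n : ℕ, detTerm χ U V W ρ X' n‖ + ‖(1 : ℂ) - (Real.exp (-(Y'⁻¹)) : ℂ)‖ + ‖-T₃‖ + ‖-T₁‖ + ‖T₂‖ := by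
          refine (norm_add_le _ _).trans (add_le_add ?_ le_rfl)
          refine (norm_add_le _ _).trans (add_le_add ?_ le_rfl)
          refine (norm_add_le _ _).trans (add_le_add ?_ le_rfl)
          exact norm_add_le _ _
      _ ≤ 512 * detConst q V W (X / R ^ 2) ρ + R ^ 2 / Y +
          (⌊V⌋₊ : ℝ) * ⌊W⌋₊ * ((1 + Y) * Real.exp (-(⌊U⌋₊ : ℝ) / Y)) +
          (⌊V⌋₊ : ℝ) * ⌊W⌋₊ * ((1 + X) * Real.exp (-(N₁ : ℝ) / X)) +
          (⌊V⌋₊ : ℝ) * ⌊W⌋₊ * ((1 + X) * Real.exp (-(N₁ : ℝ) / X)) := by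
          rw [norm_neg, norm_neg]
          exact add_le_add (add_le_add (add_le_add (add_le_add (hSX.trans hK) hexp1) hT₃') hT₁') hT₂'
      _ = E := by rw [hE]; ring
  -- average
  have hexp : detector χ U V W X Y R J N₁ ρ + 1 = ((J : ℂ) ^ 2)⁻¹ * ∑ j ∈ range J, ∑ j' ∈ range J,
      ((∑ n ∈ Icc 1 N₁, bcoef χ U V W ρ n *
          ((Real.exp (-(n / (X * R ^ (-t j j')))) - Real.exp (-(n / (Y * R ^ (-t j j')))) : ℝ) : ℂ)) + 1) := by
    have h1 : (1 : ℂ) = ((J : ℂ) ^ 2)⁻¹ * ∑ j ∈ range J, ∑ j' ∈ range J, (1 : ℂ) := by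
      rw [sum_const, sum_const, card_range, nsmul_eq_mul, nsmul_eq_mul, mul_one]; field_simp
    rw [detector]
    simp_rw [sum_add_distrib]
    rw [mul_add, ← h1]
    congr 1
    simp only [wAvg, ht]
    push_cast
    set c : ℂ := ((J : ℂ) ^ 2)⁻¹ with hc
    calc ∑ n ∈ Icc 1 N₁, bcoef χ U V W ρ n * (c * ∑ j ∈ range J, ∑ j' ∈ range J,
          (Complex.exp (-((n : ℂ) / ((X : ℂ) * ((R ^ (-scaleExp j j' J) : ℝ) : ℂ)))) -
            Complex.exp (-((n : ℂ) / ((Y : ℂ) * ((R ^ (-scaleExp j j' J) : ℝ) : ℂ))))))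
        = ∑ n ∈ Icc 1 N₁, ∑ j ∈ range J, ∑ j' ∈ range J, c * (bcoef χ U V W ρ n *
          (Complex.exp (-((n : ℂ) / ((X : ℂ) * ((R ^ (-scaleExp j j' J) : ℝ) : ℂ)))) -
            Complex.exp (-((n : ℂ) / ((Y : ℂ) * ((R ^ (-scaleExp j j' J) : ℝ) : ℂ)))))) := by
          refine sum_congr rfl fun n _ => ?_
          rw [mul_left_comm, mul_sum]
          simp_rw [mul_sum]
      _ = ∑ j ∈ range J, ∑ n ∈ Icc 1 N₁, ∑ j' ∈ range J, c * (bcoef χ U V W ρ n *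
          (Complex.exp (-((n : ℂ) / ((X : ℂ) * ((R ^ (-scaleExp j j' J) : ℝ) : ℂ)))) -
            Complex.exp (-((n : ℂ) / ((Y : ℂ) * ((R ^ (-scaleExp j j' J) : ℝ) : ℂ)))))) := sum_comm
      _ = ∑ j ∈ range J, ∑ j' ∈ range J, ∑ n ∈ Icc 1 N₁, c * (bcoef χ U V W ρ n *
          (Complex.exp (-((n : ℂ) / ((X : ℂ) * ((R ^ (-scaleExp j j' J) : ℝ) : ℂ)))) -
            Complex.exp (-((n : ℂ) / ((Y : ℂ) * ((R ^ (-scaleExp j j' J) : ℝ) : ℂ)))))) :=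
          sum_congr rfl fun j _ => sum_comm
      _ = ∑ j ∈ range J, c * ∑ j' ∈ range J, ∑ n ∈ Icc 1 N₁, (bcoef χ U V W ρ n *
          (Complex.exp (-((n : ℂ) / ((X : ℂ) * ((R ^ (-scaleExp j j' J) : ℝ) : ℂ)))) -
            Complex.exp (-((n : ℂ) / ((Y : ℂ) * ((R ^ (-scaleExp j j' J) : ℝ) : ℂ)))))) := by
          refine sum_congr rfl fun j _ => ?_
          rw [mul_sum]
          refine sum_congr rfl fun j' _ => ?_
          rw [mul_sum]
      _ = _ := by rw [← mul_sum]
  rw [hexp, norm_mul, norm_inv, norm_pow, Complex.norm_natCast]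
  calc ((J : ℝ) ^ 2)⁻¹ * ‖∑ j ∈ range J, ∑ j' ∈ range J,
        ((∑ n ∈ Icc 1 N₁, bcoef χ U V W ρ n *
          ((Real.exp (-(n / (X * R ^ (-t j j')))) - Real.exp (-(n / (Y * R ^ (-t j j')))) : ℝ) : ℂ)) + 1)‖
      ≤ ((J : ℝ) ^ 2)⁻¹ * ∑ j ∈ range J, ∑ j' ∈ range J, E := by
        refine mul_le_mul_of_nonneg_left ?_ (by positivity)
        exact (norm_sum_le _ _).trans (sum_le_sum fun j hj => (norm_sum_le _ _).trans
          (sum_le_sum fun j' hj' => hper j hj j' hj'))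
    _ = E := by rw [sum_const, sum_const, card_range, nsmul_eq_mul, nsmul_eq_mul]; field_simp

end Literature.NumberTheory.LFunctions.LFDSingle
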